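import Literature.NumberTheory.Rogawski1990.ArchStOrbFamHJumpSideH             -- ★ p850542 (this seat): the H-SIDE HEAD `stOrbFamH_jumpSide_std` over the shared rank-one datum
import Literature.NumberTheory.Automorphic.ArchEndoscopicChartSplitConeLimit       -- ★ p850415 (this seat): `measure_pos_lt_top_of_subgroup_eq` (box mass of the split chart)
import HarnessLib

/-!
# The H-SIDE residual `JumpHSideStatement` of the (J-BRICKS) split, ∀-closed and by a bare name — ED. 2 of ★ `ArchStOrbFamHJumpSideH`
# (Rogawski 1990 §8.2, §12.2; Shelstad 1979 §4)

Topic `NumberTheory/Rogawski1990`; namespace `Literature.NumberTheory.Rogawski1990` (§3) and `Literature.NumberTheory.Automorphic.UnitaryGroup` (§1–§2).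
THEOREMS ONLY (no definition, no instance, no notation, no axiom, no named fact, no `sorry`).  Cell `pub/hodgecm-mathlib`, crux H413
(`stmt-HodgeConjecture-24833`), F0∕P3c line LH3 (closer stub `stub_N9`, DIRECT ROAD N9″, organ J), skeleton v3.4b: the (J-BRICKS) residual of v3.3b is split
(LH4-p03 (g4) CERT `jumpBricks_of_statements`, v34b) into `SharedDatumExistsStatement → JumpHSideStatement → JumpGSideStatement → JumpBricksStatement`;
this file pays the H-SIDE text VERBATIM (with the reducible abbreviations `HInf L`, `Wc L` of the cert spelled out), so that
`stub_N9jumpHSide : JumpHSideStatement := stOrbFamH_jumpHSideStatement` closes by a bare name.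

WHAT IS PROVED.
* §1 `measure_image_hypBlockGL_box_pos_lt_top` — at a complex place `w`, for ANY measure `ρ` on the split torus `torusU ⊂ U(σ_w Φ₂)` finite on compacta and
  charging open sets, the standard box `B_std = {hypBlockGL x θ | (x, θ) ∈ [0,1] × [0,2π]}` has `0 < ρ B_std < ⊤` (it IS the image of the compact chart box
  `chartBoxImgLoc L {w} w` with non-empty interior, ★ `measure_pos_lt_top_of_subgroup_eq` + ★ `chartTorusHLoc_eq_torusU`).
* §2 `ne_zero_of_sharedLink` — the (LINK) conjunct of the shared datum (`μ₀′ = ρ(B_std) • (μ₀ ∕ ρ)` for every inversion-invariant Haar `ρ` on the torus)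
  forces `μ₀′ ≠ 0` (take `ρ := haar`, inversion-invariant on the commutative torus by ★ `isInvInvariant_of_comm`; `ρ(B_std) ≠ 0` by §1 and `μ₀ ∕ ρ ≠ 0` by
  ★ `quotientMeasure_ne_zero`).  So the `hμ₀′` binder of ★ `stOrbFamH_jumpSide_std` is discharged from the datum itself.
* §3 `stOrbFamH_jumpHSideStatement` — the cert's `JumpHSideStatement`, VERBATIM: frame `(L, α, νH)`, the idle diagonal hypotheses `hherm`, `hanis`, the shared
  datum `(hJ, μ₀, μ₀′, C₁, C₂, 0 < C₁, 0 < C₂, K0, A0, LINK)` on the standard carrier `U(J)`, `J = Φ₂ over ℂ`, then ★ `stOrbFamH_jumpSide_std` after `subst J := σ_w Φ₂`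
  (the (LINK) text quantifies `[ρ.IsHaarMeasure] [ρ.IsInvInvariant]`; the head's weaker binder list `[IsMulLeftInvariant] [IsFiniteMeasureOnCompacts] [IsOpenPosMeasure]
  [IsInvInvariant]` is met by `IsHaarMeasure.mk`).
HONEST LABEL: HC_CM is proved only modulo the 7 printed citations (2 remaining named inputs: hLiu418 = `stmt-HodgeConjecture-24832`, h413 = `stmt-HodgeConjecture-24833`)
until rung 0 closes; this file is count-neutral packaging of ★ p850542 and pays nothing by itself.

## References
* [Rogawski1990] J. D. Rogawski, *Automorphic Representations of Unitary Groups in Three Variables*, Ann. of Math. Stud. 123 (1990), §8.2 pp. 118–124, §12.2.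
* [Shelstad1979] D. Shelstad, *Characters and inner forms of a quasi-split group over ℝ*, Compositio Math. 39 (1979) 11–45, §4.
* [Varadarajan1989] V. S. Varadarajan, *An Introduction to Harmonic Analysis on Semisimple Lie Groups*, Cambridge Stud. Adv. Math. 16 (1989), §6.4.
-/

set_option autoImplicit false

noncomputable section

open Filter Topology MeasureTheory MeasureTheory.Measure NumberField NumberField.InfinitePlace Complex Set Function Real
open Literature.NumberTheory.Automorphic Literature.NumberTheory.Automorphic.UnitaryGroup Literature.NumberTheory.Automorphic.ArchCartan
open Literature.NumberTheory.Automorphic.Shelstad1979.StableOrbitalIntegrals Literature.MeasureTheory.Group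
open Literature.NumberTheory.Automorphic.UnitaryGroup.LineRing
open Literature.NumberTheory.Rogawski1990
open scoped MatrixGroups ENNReal NNReal Matrix ComplexOrder Classical

namespace Literature.NumberTheory.Automorphic.UnitaryGroup

/-! ## §1 The standard box of the split torus has positive finite mass -/

section Box

variable (L : Type) [Field L] [NumberField L] [IsCMField L] (w : {w : InfinitePlace L // IsComplex w})

/-- **`0 < ρ(B_std) < ⊤`.**  At a complex place `w` of the CM field `L` (so that `σ_w Φ₂ = Φ₂ over ℂ`, hypothesis `hJ`), for every measure `ρ` on the split torus
`torusU ⊂ U(σ_w Φ₂)` that is finite on compacta and charges open sets, the standard box `B_std = hypBlockGL '' ([0,1] × [0,2π])` (the set of the (LINK)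
conjunct of the shared rank-one datum) has positive finite `ρ`-mass: it is the compact chart box `chartBoxImgLoc L {w} w` (non-empty interior) of
★ `ArchEndoscopicChartMeasures`, read in `torusU` through ★ `chartTorusHLoc_eq_torusU`. [cite: Varadarajan1989, §6.4 Lemma 21] [cite: Rogawski1990, §4.9 p. 55] -/
theorem measure_image_hypBlockGL_box_pos_lt_top
    [iJ : MeasurableSpace ↥(unitaryGroupOfForm (starRingEnd ℂ) ((Matrix.of fun i j : Fin 2 => if i.val + j.val + 1 = 2 then (1 : L) else 0).map w.1.embedding))]
    [BorelSpace ↥(unitaryGroupOfForm (starRingEnd ℂ) ((Matrix.of fun i j : Fin 2 => if i.val + j.val + 1 = 2 then (1 : L) else 0).map w.1.embedding))]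
    (hJ : ((Matrix.of fun i j : Fin 2 => if i.val + j.val + 1 = 2 then (1 : L) else 0).map w.1.embedding) = (StdForm.antidiagonal 2).over ℂ)
    (ρ : Measure ↥(torusU (starRingEnd ℂ) ((Matrix.of fun i j : Fin 2 => if i.val + j.val + 1 = 2 then (1 : L) else 0).map w.1.embedding)))
    [ρ.IsOpenPosMeasure] [IsFiniteMeasureOnCompacts ρ] :
    0 < ρ ((fun p : ℝ × ℝ =>
        (⟨⟨hypBlockGL p.1 p.2, hypBlockGL_mem_of_eq_over hJ p.1 p.2⟩, hypBlockGL_mem_torusU hJ p.1 p.2⟩ :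
          ↥(torusU (starRingEnd ℂ) ((Matrix.of fun i j : Fin 2 => if i.val + j.val + 1 = 2 then (1 : L) else 0).map w.1.embedding)))) ''
          (Set.Icc (0 : ℝ) 1 ×ˢ Set.Icc (0 : ℝ) (2 * π))) ∧
      ρ ((fun p : ℝ × ℝ =>
        (⟨⟨hypBlockGL p.1 p.2, hypBlockGL_mem_of_eq_over hJ p.1 p.2⟩, hypBlockGL_mem_torusU hJ p.1 p.2⟩ :
          ↥(torusU (starRingEnd ℂ) ((Matrix.of fun i j : Fin 2 => if i.val + j.val + 1 = 2 then (1 : L) else 0).map w.1.embedding)))) ''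
          (Set.Icc (0 : ℝ) 1 ×ˢ Set.Icc (0 : ℝ) (2 * π))) < ⊤ := by
  have hiJ : iJ = borel _ := BorelSpace.measurable_eq
  subst hiJ
  letI iW : MeasurableSpace (↥(archLocal L 2 (Matrix.of fun i j : Fin 2 => if i.val + j.val + 1 = 2 then (1 : L) else 0) w)) := borel _
  haveI : BorelSpace (↥(archLocal L 2 (Matrix.of fun i j : Fin 2 => if i.val + j.val + 1 = 2 then (1 : L) else 0) w)) := ⟨rfl⟩
  have hw1 : w ∈ ({w} : Finset {w : InfinitePlace L // IsComplex w}) := Finset.mem_singleton_self w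
  let TAL : Subgroup ↥(archLocal L 2 (Matrix.of fun i j : Fin 2 => if i.val + j.val + 1 = 2 then (1 : L) else 0) w) :=
    torusU (starRingEnd ℂ) ((Matrix.of fun i j : Fin 2 => if i.val + j.val + 1 = 2 then (1 : L) else 0).map w.1.embedding)
  let ρAL : Measure ↥TAL := ρ
  haveI : ρAL.IsOpenPosMeasure := ‹ρ.IsOpenPosMeasure›
  haveI : IsFiniteMeasureOnCompacts ρAL := ‹IsFiniteMeasureOnCompacts ρ›
  obtain ⟨hBpos, hBfin⟩ := measure_pos_lt_top_of_subgroup_eq (T' := TAL) (chartTorusHLoc_eq_torusU L {w} hw1) (chartBoxImgLoc L {w} w)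
    (isCompact_chartBoxImgLoc L {w} w) (nonempty_interior_chartBoxImgLoc L {w} w) ρAL
  -- the chart box of the label `{w}` at `w`, read in `torusU`, IS `B_std`
  have hbox : {m : ↥TAL | (m : ↥(archLocal L 2 (Matrix.of fun i j : Fin 2 => if i.val + j.val + 1 = 2 then (1 : L) else 0) w)) ∈ ((↑) : ↥(chartTorusHLoc L {w} w) → ↥(archLocal L 2 (Matrix.of fun i j : Fin 2 => if i.val + j.val + 1 = 2 then (1 : L) else 0) w)) '' chartBoxImgLoc L {w} w} =
      (fun p : ℝ × ℝ => (⟨⟨hypBlockGL p.1 p.2, hypBlockGL_mem_of_eq_over hJ p.1 p.2⟩, hypBlockGL_mem_torusU hJ p.1 p.2⟩ : ↥(torusU (starRingEnd ℂ) ((Matrix.of fun i j : Fin 2 => if i.val + j.val + 1 = 2 then (1 : L) else 0).map w.1.embedding)))) ''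
        (Set.Icc (0 : ℝ) 1 ×ˢ Set.Icc (0 : ℝ) (2 * π)) := by
    ext m
    constructor
    · rintro ⟨t, ⟨cw, hcw, rfl⟩, hmt⟩
      have h0 : cw 0 ∈ Set.Icc (0 : ℝ) 1 := by
        simpa [hw1] using hcw 0 (Set.mem_univ _)
      have h2 : cw 2 ∈ Set.Icc (0 : ℝ) (2 * π) := by
        simpa using hcw 2 (Set.mem_univ _)
      refine ⟨(cw 0, cw 2), ⟨h0, h2⟩, Subtype.ext ?_⟩
      rw [← hmt]
      exact (endoBlockAt_eq_mk_hypBlockGL L {w} hw1 cw).symm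
    · rintro ⟨p, ⟨hx, hθ⟩, rfl⟩
      refine ⟨⟨endoBlockAt L {w} w ![p.1, 0, p.2], endoBlockAt_mem_chartTorusHLoc L {w} w _⟩, ⟨![p.1, 0, p.2], ?_, rfl⟩, ?_⟩
      · intro i _
        fin_cases i
        · simpa [hw1] using hx
        · refine ⟨le_rfl, ?_⟩
          split_ifs
          · exact zero_le_one
          · positivity
        · simpa using hθ
      · exact endoBlockAt_eq_mk_hypBlockGL L {w} hw1 ![p.1, 0, p.2]
  rw [hbox] at hBpos hBfin
  exact ⟨hBpos, hBfin⟩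

end Box

/-! ## §2 The (LINK) conjunct of the shared rank-one datum forces `μ₀′ ≠ 0` -/

section Link

variable (L : Type) [Field L] [NumberField L] [IsCMField L] (w : {w : InfinitePlace L // IsComplex w})

/-- **`μ₀′ ≠ 0` from (LINK).**  If `μ₀′ = ρ(B_std) • (μ₀ ∕ ρ)` for every inversion-invariant Haar measure `ρ` on the split torus `torusU ⊂ U(σ_w Φ₂)` (the (LINK)
conjunct of the shared rank-one datum, `μ₀` a Haar measure on `U(σ_w Φ₂)`), then `μ₀′ ≠ 0`: take `ρ := haar` (inversion-invariant, the torus being commutative,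
★ `isInvInvariant_of_comm`); `ρ(B_std) ≠ 0` (§1) and `μ₀ ∕ ρ ≠ 0` (★ `quotientMeasure_ne_zero`). [cite: Varadarajan1989, §6.4 Lemma 21] [cite: Rogawski1990, §4.9 p. 55] -/
theorem ne_zero_of_sharedLink
    [iJ : MeasurableSpace ↥(unitaryGroupOfForm (starRingEnd ℂ) ((Matrix.of fun i j : Fin 2 => if i.val + j.val + 1 = 2 then (1 : L) else 0).map w.1.embedding))]
    [BorelSpace ↥(unitaryGroupOfForm (starRingEnd ℂ) ((Matrix.of fun i j : Fin 2 => if i.val + j.val + 1 = 2 then (1 : L) else 0).map w.1.embedding))]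
    [LocallyCompactSpace ↥(unitaryGroupOfForm (starRingEnd ℂ) ((Matrix.of fun i j : Fin 2 => if i.val + j.val + 1 = 2 then (1 : L) else 0).map w.1.embedding))]
    [SecondCountableTopology ↥(unitaryGroupOfForm (starRingEnd ℂ) ((Matrix.of fun i j : Fin 2 => if i.val + j.val + 1 = 2 then (1 : L) else 0).map w.1.embedding))]
    (hJ : ((Matrix.of fun i j : Fin 2 => if i.val + j.val + 1 = 2 then (1 : L) else 0).map w.1.embedding) = (StdForm.antidiagonal 2).over ℂ)
    (μ₀ : Measure ↥(unitaryGroupOfForm (starRingEnd ℂ) ((Matrix.of fun i j : Fin 2 => if i.val + j.val + 1 = 2 then (1 : L) else 0).map w.1.embedding)))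
    [μ₀.IsHaarMeasure] [μ₀.IsMulRightInvariant]
    [iQ : MeasurableSpace (↥(unitaryGroupOfForm (starRingEnd ℂ) ((Matrix.of fun i j : Fin 2 => if i.val + j.val + 1 = 2 then (1 : L) else 0).map w.1.embedding)) ⧸
      torusU (starRingEnd ℂ) ((Matrix.of fun i j : Fin 2 => if i.val + j.val + 1 = 2 then (1 : L) else 0).map w.1.embedding))]
    [BorelSpace (↥(unitaryGroupOfForm (starRingEnd ℂ) ((Matrix.of fun i j : Fin 2 => if i.val + j.val + 1 = 2 then (1 : L) else 0).map w.1.embedding)) ⧸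
      torusU (starRingEnd ℂ) ((Matrix.of fun i j : Fin 2 => if i.val + j.val + 1 = 2 then (1 : L) else 0).map w.1.embedding))]
    (μ₀' : Measure (↥(unitaryGroupOfForm (starRingEnd ℂ) ((Matrix.of fun i j : Fin 2 => if i.val + j.val + 1 = 2 then (1 : L) else 0).map w.1.embedding)) ⧸
      torusU (starRingEnd ℂ) ((Matrix.of fun i j : Fin 2 => if i.val + j.val + 1 = 2 then (1 : L) else 0).map w.1.embedding)))
    (hlink : ∀ (ρ : Measure ↥(torusU (starRingEnd ℂ) ((Matrix.of fun i j : Fin 2 => if i.val + j.val + 1 = 2 then (1 : L) else 0).map w.1.embedding)))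
      [ρ.IsHaarMeasure] [ρ.IsInvInvariant],
      μ₀' = ρ ((fun p : ℝ × ℝ =>
        (⟨⟨hypBlockGL p.1 p.2, hypBlockGL_mem_of_eq_over hJ p.1 p.2⟩, hypBlockGL_mem_torusU hJ p.1 p.2⟩ :
          ↥(torusU (starRingEnd ℂ) ((Matrix.of fun i j : Fin 2 => if i.val + j.val + 1 = 2 then (1 : L) else 0).map w.1.embedding)))) ''
          (Set.Icc (0 : ℝ) 1 ×ˢ Set.Icc (0 : ℝ) (2 * π))) •
        quotientMeasure (torusU (starRingEnd ℂ) ((Matrix.of fun i j : Fin 2 => if i.val + j.val + 1 = 2 then (1 : L) else 0).map w.1.embedding)) ρ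
          (LineRing.isClosed_torusU_two (starRingEnd ℂ) ((Matrix.of fun i j : Fin 2 => if i.val + j.val + 1 = 2 then (1 : L) else 0).map w.1.embedding)) μ₀) :
    μ₀' ≠ 0 := by
  have hTc : IsClosed (((torusU (starRingEnd ℂ) ((Matrix.of fun i j : Fin 2 => if i.val + j.val + 1 = 2 then (1 : L) else 0).map w.1.embedding)) : Subgroup ↥(unitaryGroupOfForm (starRingEnd ℂ) ((Matrix.of fun i j : Fin 2 => if i.val + j.val + 1 = 2 then (1 : L) else 0).map w.1.embedding))) : Set ↥(unitaryGroupOfForm (starRingEnd ℂ) ((Matrix.of fun i j : Fin 2 => if i.val + j.val + 1 = 2 then (1 : L) else 0).map w.1.embedding))) :=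
    isClosed_torusU_two _ _
  haveI : LocallyCompactSpace ↥(torusU (starRingEnd ℂ) ((Matrix.of fun i j : Fin 2 => if i.val + j.val + 1 = 2 then (1 : L) else 0).map w.1.embedding)) :=
    hTc.isClosedEmbedding_subtypeVal.locallyCompactSpace
  haveI : SecondCountableTopology ↥(torusU (starRingEnd ℂ) ((Matrix.of fun i j : Fin 2 => if i.val + j.val + 1 = 2 then (1 : L) else 0).map w.1.embedding)) :=
    TopologicalSpace.Subtype.secondCountableTopology _
  haveI : BorelSpace ↥(torusU (starRingEnd ℂ) ((Matrix.of fun i j : Fin 2 => if i.val + j.val + 1 = 2 then (1 : L) else 0).map w.1.embedding)) := Subtype.borelSpace _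
  set ρ : Measure ↥(torusU (starRingEnd ℂ) ((Matrix.of fun i j : Fin 2 => if i.val + j.val + 1 = 2 then (1 : L) else 0).map w.1.embedding)) := Measure.haar with hρ
  haveI : ρ.IsInvInvariant :=
    Literature.MeasureTheory.Group.isInvInvariant_of_comm _ hTc (fun x hx y hy => LineRing.forall_mem_torusU_comm (starRingEnd ℂ) _ hy x hx) ρ
  obtain ⟨hpos, -⟩ := measure_image_hypBlockGL_box_pos_lt_top L w hJ ρ
  have hQ := quotientMeasure_ne_zero (torusU (starRingEnd ℂ) ((Matrix.of fun i j : Fin 2 => if i.val + j.val + 1 = 2 then (1 : L) else 0).map w.1.embedding)) ρ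
    (LineRing.isClosed_torusU_two (starRingEnd ℂ) ((Matrix.of fun i j : Fin 2 => if i.val + j.val + 1 = 2 then (1 : L) else 0).map w.1.embedding)) μ₀
  intro h0
  apply hQ
  have h := hlink ρ
  rw [h0] at h
  have hu := congrArg (fun m : Measure (↥(unitaryGroupOfForm (starRingEnd ℂ) ((Matrix.of fun i j : Fin 2 => if i.val + j.val + 1 = 2 then (1 : L) else 0).map w.1.embedding)) ⧸
      torusU (starRingEnd ℂ) ((Matrix.of fun i j : Fin 2 => if i.val + j.val + 1 = 2 then (1 : L) else 0).map w.1.embedding)) => m Set.univ) h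
  simp only [Measure.coe_zero, Pi.zero_apply, Measure.smul_apply, smul_eq_mul] at hu
  exact Measure.measure_univ_eq_zero.1 ((mul_eq_zero.1 hu.symm).resolve_left hpos.ne')

end Link

end Literature.NumberTheory.Automorphic.UnitaryGroup

namespace Literature.NumberTheory.Rogawski1990

/-! ## §3 The cert's `JumpHSideStatement`, VERBATIM, by a bare name -/

set_option maxHeartbeats 400000 in
/-- **(H-SIDE) residual of the (J-BRICKS) split, VERBATIM** (LH4-p03 (g4) CERT v34b `JumpHSideStatement`, the reducible abbreviations `HInf L`, `Wc L` spelled out):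
for every CM frame `(L, α, νH)` (the diagonal hypotheses `hherm`, `hanis` are idle here), every shared rank-one datum `(hJ, μ₀, μ₀′, C₁, C₂)` on the standard
carrier `U(J)`, `J = Φ₂ over ℂ`, with `0 < C₁` (idle), `0 < C₂`, the (K0±) jump property of `μ₀` with `C₁`, the (A0) cone-limit property of `μ₀′` with `C₂` and the
(LINK) `μ₀′ = ρ(B_std) • (μ₀ ∕ ρ)`: at every `G`-semiregular point `s` of a covered admissible wall `(S, w)`, if every smooth `fH` has `SO^{H,st}(fH)` smooth-bounded,
there is a smooth `fH` whose stable family jumps across the wall by `(2·I·C₁ ∕ C₂) · SO^{H,st}_{S ∪ {w}}(fH)(cayPt w s)`, that Cayley value being `≠ 0`.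
Proof: `σ_w Φ₂ = Φ₂ over ℂ = J` (`subst`), `μ₀′ ≠ 0` by ★ `ne_zero_of_sharedLink`, then ★ `stOrbFamH_jumpSide_std` (its (LINK) binder asks only
`[IsMulLeftInvariant] [IsFiniteMeasureOnCompacts] [IsOpenPosMeasure] [IsInvInvariant]` of `ρ`, which make `ρ` a Haar measure).
[cite: Rogawski1990, §8.2 pp. 118–124, §12.2] [cite: Shelstad1979, §4 Lemma 4.3] -/
theorem stOrbFamH_jumpHSideStatement :
  ∀ (L : Type) [Field L] [NumberField L] [IsCMField L] (α : Fin 3 → L)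
    [MeasurableSpace (↥(arch (↥(maximalRealSubfield L)) L (IsCMField.complexConj L) 2 (Matrix.of fun i j : Fin 2 => if i.val + j.val + 1 = 2 then (1 : L) else 0)) ×
        ↥(arch (↥(maximalRealSubfield L)) L (IsCMField.complexConj L) 1 (Matrix.of fun i j : Fin 1 => if i.val + j.val + 1 = 1 then (1 : L) else 0)))] [BorelSpace (↥(arch (↥(maximalRealSubfield L)) L (IsCMField.complexConj L) 2 (Matrix.of fun i j : Fin 2 => if i.val + j.val + 1 = 2 then (1 : L) else 0)) ×
        ↥(arch (↥(maximalRealSubfield L)) L (IsCMField.complexConj L) 1 (Matrix.of fun i j : Fin 1 => if i.val + j.val + 1 = 1 then (1 : L) else 0)))] (νH : Measure (↥(arch (↥(maximalRealSubfield L)) L (IsCMField.complexConj L) 2 (Matrix.of fun i j : Fin 2 => if i.val + j.val + 1 = 2 then (1 : L) else 0)) ×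
        ↥(arch (↥(maximalRealSubfield L)) L (IsCMField.complexConj L) 1 (Matrix.of fun i j : Fin 1 => if i.val + j.val + 1 = 1 then (1 : L) else 0)))) [νH.IsHaarMeasure] [νH.IsMulRightInvariant],
    ((Matrix.diagonal α).map (cmConjRingHom L)).transpose = Matrix.diagonal α →
    (∀ x : Fin 3 → L, Literature.AlgebraicGeometry.ShimuraVarieties.hermForm (cmConjRingHom L) (Matrix.diagonal α) x x = 0 → x = 0) →
    ∀ {J : Matrix (Fin 2) (Fin 2) ℂ} (hJ : J = (StdForm.antidiagonal 2).over ℂ)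
      [MeasurableSpace ↥(unitaryGroupOfForm (starRingEnd ℂ) J)] [BorelSpace ↥(unitaryGroupOfForm (starRingEnd ℂ) J)]
      [LocallyCompactSpace ↥(unitaryGroupOfForm (starRingEnd ℂ) J)] [SecondCountableTopology ↥(unitaryGroupOfForm (starRingEnd ℂ) J)]
      [MeasurableSpace (↥(unitaryGroupOfForm (starRingEnd ℂ) J) ⧸ torusU (starRingEnd ℂ) J)] [BorelSpace (↥(unitaryGroupOfForm (starRingEnd ℂ) J) ⧸ torusU (starRingEnd ℂ) J)]
      (μ₀ : Measure ↥(unitaryGroupOfForm (starRingEnd ℂ) J)) [μ₀.IsHaarMeasure] [μ₀.IsMulRightInvariant]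
      (μ₀' : Measure (↥(unitaryGroupOfForm (starRingEnd ℂ) J) ⧸ torusU (starRingEnd ℂ) J)) [SMulInvariantMeasure ↥(unitaryGroupOfForm (starRingEnd ℂ) J) (↥(unitaryGroupOfForm (starRingEnd ℂ) J) ⧸ torusU (starRingEnd ℂ) J) μ₀'] [IsFiniteMeasureOnCompacts μ₀']
      (C₁ C₂ : ℝ), 0 < C₁ → 0 < C₂ →
      (∀ (f : Matrix (Fin 2) (Fin 2) ℂ → ℂ), Continuous f → HasCompactSupport f → ∀ z : Circle,
        HasOneSidedJump (fun ψ : ℝ => (2 * Real.sin ψ : ℂ) *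
            ∫ h : ↥(unitaryGroupOfForm (starRingEnd ℂ) J),
              f (((h * ⟨Matrix.GeneralLinearGroup.mkOfDetNeZero !![(1 : ℂ), 1; 1, -1] det_cayleyTwo_ne_zero *
                    circleDiagonal 2 ![z * Circle.exp ψ, z * Circle.exp (-ψ)] *
                    (Matrix.GeneralLinearGroup.mkOfDetNeZero !![(1 : ℂ), 1; 1, -1] det_cayleyTwo_ne_zero)⁻¹,
                  cayley_conj_circleDiagonal_mem_of_eq_over hJ _⟩ * h⁻¹ :
                ↥(unitaryGroupOfForm (starRingEnd ℂ) J)) : GL (Fin 2) ℂ) : Matrix (Fin 2) (Fin 2) ℂ) ∂μ₀)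
          ((C₁ : ℂ) * ((∫ p in Ioi (0 : ℝ) ×ˢ Ioc (0 : ℝ) (2 * π),
              f ((!![(1 : ℂ), 1; 1, -1] : Matrix (Fin 2) (Fin 2) ℂ) *
                ((z : ℂ) • (1 : Matrix (Fin 2) (Fin 2) ℂ) + p.1 • Matrix.diagonal ![(z : ℂ) * I, -((z : ℂ) * I)] +
                  p.1 • !![(0 : ℂ), -((z : ℂ) * I) * cexp (-((p.2 : ℂ) * I)); ((z : ℂ) * I) * cexp ((p.2 : ℂ) * I), 0]) *
                !![(1 / 2 : ℂ), 1 / 2; 1 / 2, -(1 / 2)])) +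
            ∫ p in Ioi (0 : ℝ) ×ˢ Ioc (0 : ℝ) (2 * π),
              f ((!![(1 : ℂ), 1; 1, -1] : Matrix (Fin 2) (Fin 2) ℂ) *
                ((z : ℂ) • (1 : Matrix (Fin 2) (Fin 2) ℂ) + p.1 • Matrix.diagonal ![-((z : ℂ) * I), (z : ℂ) * I] +
                  p.1 • !![(0 : ℂ), ((z : ℂ) * I) * cexp (-((p.2 : ℂ) * I)); -((z : ℂ) * I) * cexp ((p.2 : ℂ) * I), 0]) *
                !![(1 / 2 : ℂ), 1 / 2; 1 / 2, -(1 / 2)])))) →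
      (∀ (f : Matrix (Fin 2) (Fin 2) ℂ → ℂ), Continuous f → HasCompactSupport f → ∀ θ : ℝ,
      Tendsto (fun x : ℝ => |Real.exp x - Real.exp (-x)| •
          ∫ y, descConj (⟨hypBlockGL x θ, hypBlockGL_mem_of_eq_over hJ x θ⟩ : ↥(unitaryGroupOfForm (starRingEnd ℂ) J)) (torusU (starRingEnd ℂ) J)
            (LineRing.forall_mem_torusU_comm (starRingEnd ℂ) J (hypBlockGL_mem_torusU hJ x θ))
            (fun g : ↥(unitaryGroupOfForm (starRingEnd ℂ) J) => f ((g : GL (Fin 2) ℂ) : Matrix (Fin 2) (Fin 2) ℂ)) y ∂μ₀')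
        (𝓝[≠] 0)
        (𝓝 (C₂ • ((∫ p in Ioi (0 : ℝ) ×ˢ Ioc (0 : ℝ) (2 * π),
            f ((!![(1 : ℂ), 1; 1, -1] : Matrix (Fin 2) (Fin 2) ℂ) *
              (Complex.exp ((θ : ℂ) * Complex.I) • (1 : Matrix (Fin 2) (Fin 2) ℂ) +
                p.1 • Matrix.diagonal ![Complex.exp ((θ : ℂ) * Complex.I) * Complex.I, -(Complex.exp ((θ : ℂ) * Complex.I) * Complex.I)] +
                p.1 • !![(0 : ℂ), -(Complex.exp ((θ : ℂ) * Complex.I) * Complex.I) * Complex.exp (-((p.2 : ℂ) * Complex.I));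
                  (Complex.exp ((θ : ℂ) * Complex.I) * Complex.I) * Complex.exp ((p.2 : ℂ) * Complex.I), 0]) *
              !![(1 / 2 : ℂ), 1 / 2; 1 / 2, -(1 / 2)])) +
          ∫ p in Ioi (0 : ℝ) ×ˢ Ioc (0 : ℝ) (2 * π),
            f ((!![(1 : ℂ), 1; 1, -1] : Matrix (Fin 2) (Fin 2) ℂ) *
              (Complex.exp ((θ : ℂ) * Complex.I) • (1 : Matrix (Fin 2) (Fin 2) ℂ) +
                p.1 • Matrix.diagonal ![-(Complex.exp ((θ : ℂ) * Complex.I) * Complex.I), Complex.exp ((θ : ℂ) * Complex.I) * Complex.I] +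
                p.1 • !![(0 : ℂ), (Complex.exp ((θ : ℂ) * Complex.I) * Complex.I) * Complex.exp (-((p.2 : ℂ) * Complex.I));
                  -(Complex.exp ((θ : ℂ) * Complex.I) * Complex.I) * Complex.exp ((p.2 : ℂ) * Complex.I), 0]) *
              !![(1 / 2 : ℂ), 1 / 2; 1 / 2, -(1 / 2)]))))) →
      (∀ (ρ : Measure ↥(torusU (starRingEnd ℂ) J)) [ρ.IsHaarMeasure] [ρ.IsInvInvariant],
    μ₀' = ρ ((fun p : ℝ × ℝ =>
        (⟨⟨hypBlockGL p.1 p.2, hypBlockGL_mem_of_eq_over hJ p.1 p.2⟩, hypBlockGL_mem_torusU hJ p.1 p.2⟩ : ↥(torusU (starRingEnd ℂ) J))) ''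
          (Set.Icc (0 : ℝ) 1 ×ˢ Set.Icc (0 : ℝ) (2 * π))) •
      quotientMeasure (torusU (starRingEnd ℂ) J) ρ (LineRing.isClosed_torusU_two (starRingEnd ℂ) J) μ₀) →
    ∀ (S : Finset {w : InfinitePlace L // w.IsComplex}) (w : {w : InfinitePlace L // w.IsComplex}) (s : {w : InfinitePlace L // w.IsComplex} → Fin 3 → ℝ),
      (∀ w' ∈ S, w' ∈ splitChartPlaces L α) → IsCoveredWall (slotSign L α) S w → HcSemireg S w 0 2 s →
      (∀ fH : (↥(arch (↥(maximalRealSubfield L)) L (IsCMField.complexConj L) 2 (Matrix.of fun i j : Fin 2 => if i.val + j.val + 1 = 2 then (1 : L) else 0)) ×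
        ↥(arch (↥(maximalRealSubfield L)) L (IsCMField.complexConj L) 1 (Matrix.of fun i j : Fin 1 => if i.val + j.val + 1 = 1 then (1 : L) else 0))) → ℂ, ArchSmooth₂ L fH → ArchBzSmoothBounded (stOrbFamH L νH fH)) →
        ∃ fH : (↥(arch (↥(maximalRealSubfield L)) L (IsCMField.complexConj L) 2 (Matrix.of fun i j : Fin 2 => if i.val + j.val + 1 = 2 then (1 : L) else 0)) ×
        ↥(arch (↥(maximalRealSubfield L)) L (IsCMField.complexConj L) 1 (Matrix.of fun i j : Fin 1 => if i.val + j.val + 1 = 1 then (1 : L) else 0))) → ℂ, ArchSmooth₂ L fH ∧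
          HasOneSidedJump (fun ν : ℝ => stOrbFamH L νH fH S (s + ν • nrm w)) ((2 * I * C₁ / C₂ : ℂ) * stOrbFamH L νH fH (insert w S) (cayPt w s)) ∧
          stOrbFamH L νH fH (insert w S) (cayPt w s) ≠ 0 := by
  intro L _ _ _ α iH iHB νH _ _ _hherm _hanis J hJ iJ iJB iLC iSC iQ iQB μ₀ _ _ μ₀' _ _ C₁ C₂ _hC₁ hC₂ hK0 hA0 hlink S w s hS hcov hsr hsmH
  -- `σ_w Φ₂ = Φ₂ over ℂ = J`
  have hJ₀ : ((Matrix.of fun i j : Fin 2 => if i.val + j.val + 1 = 2 then (1 : L) else 0).map w.1.embedding) = (StdForm.antidiagonal 2).over ℂ := by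
    rw [Literature.NumberTheory.Rogawski1990.antidiagOne_map, StdForm.over_antidiagonal_eq]
  obtain rfl : J = ((Matrix.of fun i j : Fin 2 => if i.val + j.val + 1 = 2 then (1 : L) else 0).map w.1.embedding) := hJ.trans hJ₀.symm
  have hμ₀' : μ₀' ≠ 0 := ne_zero_of_sharedLink L w hJ μ₀ μ₀' hlink
  exact stOrbFamH_jumpSide_std L α νH hJ μ₀ μ₀' C₁ C₂ hC₂ hK0 hA0 hμ₀'
    (fun ρ _ _ _ _ => by
      haveI : ρ.IsHaarMeasure := { }
      exact hlink ρ) S w s hS hcov hsr hsmH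

end Literature.NumberTheory.Rogawski1990
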